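import Mathlib.RingTheory.Derivation.Basic
import Mathlib.RingTheory.Ideal.Maps
import Mathlib.Algebra.BigOperators.Group.Finset.Piecewise

/-!
# The log-content of `φ(a)`: refined reverse inclusion of the round lemma (rich base)

Helper file for the stub `content_le_map_univ_sup_of_rich` (V1, the REFINED reverse inclusion of
the round lemma, boundary terms kept explicit) of the line `pfaff-line-log-final-forms` (crux
`Valuative.LuAlphaPTorsor`, item `stmt-ResolutionOfSingularities-0641`).

Setting: `R` a commutative ring with elements `u : Fin d → R` admitting DUAL `ℤ`-derivations
`D_i(u_j) = δ_ij`, a boundary `E ⊆ Fin d`, and the LOG-CONTENT IDEAL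
`C_E(a; R) := Ideal.span {δ a | δ ∈ Der_ℤ(R), δ(u_i) ∈ (u_i) ∀ i ∈ E}`. Along a ring homomorphism
`φ : R → S` (`S` with elements `u'`, boundary `E'`), write
`I_i := Ideal.span {δ'(φ u_i) | δ' ∈ Der_ℤ(S) E'-logarithmic}`.

* `content_le_map_univ_sup_of_rich` — if `R` is RICH (every `ψ`-derivation `R → N` agrees, on any
  finite set, with a finite `N`-combination of genuine `ℤ`-derivations of `R`), then
  `C_{E'}(φ a; S) ≤ C_univ(a; R) · S + ∑_i I_i · (φ(D_i a))`.

Proof: for `δ'` an `E'`-logarithmic derivation of `S`, expand the `φ`-derivation `δ' ∘ φ` on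
`{a, u_1, …, u_d}` as `∑_j φ(Δ_j ·) n_j`; correct each `Δ_j` into the everywhere-logarithmic
`Δ⁰_j = Δ_j - ∑_i Δ_j(u_i) D_i` (it kills every `u_i`); then
`δ'(φ a) = ∑_j φ(Δ⁰_j a) n_j + ∑_i φ(D_i a) δ'(φ u_i)`; the first sum lies in `C_univ(a) · S`
and the `i`-th term of the second lies in `I_i · (φ(D_i a))`, `δ'(φ u_i)` being a generator of
`I_i`.
-/

set_option linter.dupNamespace false

namespace Summit.ResolutionOfSingularities.ResolutionOfSingularities.Theorems.PfaffLine

section ContentRefined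

variable {R S : Type} [CommRing R] [CommRing S] [Algebra ℤ R] [Algebra ℤ S]

/-- Evaluating a finite sum of derivations. [folklore] -/
private theorem derivation_sum_apply_contentRefined {ι : Type*} (s : Finset ι)
    (f : ι → Derivation ℤ R R) (y : R) : (∑ l ∈ s, f l) y = ∑ l ∈ s, f l y := by
  induction s using Finset.cons_induction with
  | empty => simp
  | cons a s ha ih => rw [Finset.sum_cons, Finset.sum_cons, Derivation.add_apply, ih]

/-- **Refined reverse inclusion of the round lemma** (boundary terms explicit): when `R` is rich
in `ℤ`-derivations (with dual derivations `D_i` of `u`), for every boundary `E ⊆ Fin d`,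
`C_{E'}(φ a; S) ≤ C_E(a; R) · S + ∑_i I_i · (φ(D_i a))`, where `I_i` is the ideal generated by the
values `δ'(φ u_i)` of the `E'`-logarithmic derivations `δ'` of `S`. [folklore] -/
theorem content_le_map_sup_of_rich_aux (φ : R →+* S)
    (hrich : ∀ (N : Type) [CommRing N] (ψ : R →+* N) (δ₀ : R →+ N),
      (∀ a b, δ₀ (a * b) = ψ a * δ₀ b + ψ b * δ₀ a) → ∀ Y : Finset R,
      ∃ (m : ℕ) (Δ : Fin m → Derivation ℤ R R) (nn : Fin m → N),
        ∀ y ∈ Y, δ₀ y = Finset.univ.sum fun j => ψ (Δ j y) * nn j)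
    {d d' : ℕ} (u : Fin d → R) (E : Finset (Fin d)) (D : Fin d → Derivation ℤ R R)
    (hD : ∀ i j, D i (u j) = if i = j then 1 else 0) (u' : Fin d' → S) (E' : Finset (Fin d'))
    (a : R) :
    Ideal.span {b | ∃ δ' : Derivation ℤ S S, (∀ j ∈ E', δ' (u' j) ∈ Ideal.span {u' j}) ∧
      δ' (φ a) = b} ≤
    (Ideal.span {b | ∃ δ : Derivation ℤ R R, (∀ i ∈ E, δ (u i) ∈ Ideal.span {u i}) ∧
      δ a = b}).map φ ⊔
    ⨆ i : Fin d, Ideal.span {b | ∃ δ' : Derivation ℤ S S,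
      (∀ j ∈ E', δ' (u' j) ∈ Ideal.span {u' j}) ∧ δ' (φ (u i)) = b} *
      Ideal.span {φ (D i a)} := by
  classical
  set C : Ideal R := Ideal.span {b | ∃ δ : Derivation ℤ R R,
    (∀ i ∈ E, δ (u i) ∈ Ideal.span {u i}) ∧ δ a = b} with hC
  -- the image of an `E`-logarithmic derivative of `a` lies in `C · S`
  have hmemC : ∀ δ : Derivation ℤ R R, (∀ i ∈ E, δ (u i) ∈ Ideal.span {u i}) →
      φ (δ a) ∈ C.map φ :=
    fun δ hδ => Ideal.mem_map_of_mem φ (Ideal.subset_span ⟨δ, hδ, rfl⟩)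
  refine Ideal.span_le.mpr ?_
  rintro b ⟨δ', hδ', rfl⟩
  rw [SetLike.mem_coe]
  -- pull `δ'` back to a `φ`-derivation of `R`
  let δ₀ : R →+ S :=
    { toFun := fun y => δ' (φ y)
      map_zero' := by rw [map_zero, map_zero]
      map_add' := fun x y => by rw [map_add, map_add] }
  have hδ₀apply : ∀ y, δ₀ y = δ' (φ y) := fun y => rfl
  have hleib : ∀ x y, δ₀ (x * y) = φ x * δ₀ y + φ y * δ₀ x := fun x y => by
    rw [hδ₀apply, hδ₀apply, hδ₀apply, map_mul, Derivation.leibniz, smul_eq_mul, smul_eq_mul]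
  -- richness: expand `δ' ∘ φ` on `{a, u_1, …, u_d}`
  obtain ⟨m, Δ, nn, hΔ⟩ := hrich S φ δ₀ hleib (insert a (Finset.univ.image u))
  have hexp_a : δ' (φ a) = ∑ j, φ (Δ j a) * nn j := hΔ a (Finset.mem_insert_self _ _)
  have hexp_u : ∀ i, δ' (φ (u i)) = ∑ j, φ (Δ j (u i)) * nn j := fun i =>
    hΔ (u i) (Finset.mem_insert_of_mem (Finset.mem_image_of_mem u (Finset.mem_univ i)))
  -- the corrected derivations `Δ_j - ∑_l Δ_j(u_l) D_l` kill every `u_i`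
  have hcorr : ∀ j y, (Δ j - ∑ l, Δ j (u l) • D l) y = Δ j y - ∑ l, Δ j (u l) * D l y := by
    intro j y
    rw [Derivation.sub_apply, derivation_sum_apply_contentRefined]
    rfl
  have hlog : ∀ j i, (Δ j - ∑ l, Δ j (u l) • D l) (u i) ∈ Ideal.span {u i} := by
    intro j i
    rw [hcorr]
    simp only [hD, mul_ite, mul_one, mul_zero, Finset.sum_ite_eq', Finset.mem_univ, if_true,
      sub_self]
    exact zero_mem _
  have hΔ0mem : ∀ j, φ ((Δ j - ∑ l, Δ j (u l) • D l) a) ∈ C.map φ :=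
    fun j => hmemC _ fun i _ => hlog j i
  -- each term `φ(D_i a) δ'(φ u_i)` lies in `I_i · (φ(D_i a))`, hence in the supremum
  have hDterm : ∀ i, φ (D i a) * δ' (φ (u i)) ∈ ⨆ i : Fin d,
      Ideal.span {b | ∃ δ'' : Derivation ℤ S S, (∀ j ∈ E', δ'' (u' j) ∈ Ideal.span {u' j}) ∧
        δ'' (φ (u i)) = b} * Ideal.span {φ (D i a)} := by
    intro i
    refine Ideal.mem_iSup_of_mem i ?_
    have hgen : δ' (φ (u i)) ∈ Ideal.span {b | ∃ δ'' : Derivation ℤ S S,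
        (∀ j ∈ E', δ'' (u' j) ∈ Ideal.span {u' j}) ∧ δ'' (φ (u i)) = b} :=
      Ideal.subset_span ⟨δ', hδ', rfl⟩
    exact Ideal.mul_mem_mul_rev hgen (Ideal.mem_span_singleton_self _)
  -- the expansion `δ'(φ a) = ∑_j φ(Δ⁰_j a) n_j + ∑_i φ(D_i a) δ'(φ u_i)`
  have key : δ' (φ a) = ∑ j, φ ((Δ j - ∑ l, Δ j (u l) • D l) a) * nn j +
      ∑ i, φ (D i a) * δ' (φ (u i)) := by
    have h1 : ∀ j, φ (Δ j a) * nn j = φ ((Δ j - ∑ l, Δ j (u l) • D l) a) * nn j +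
        ∑ l, φ (D l a) * (φ (Δ j (u l)) * nn j) := by
      intro j
      rw [hcorr, map_sub, map_sum, sub_mul, Finset.sum_mul]
      have e2 : ∑ l, φ (D l a) * (φ (Δ j (u l)) * nn j) = ∑ l, φ (Δ j (u l) * D l a) * nn j := by
        refine Finset.sum_congr rfl fun l _ => ?_
        rw [map_mul]
        ring
      rw [e2]
      ring
    rw [hexp_a, Finset.sum_congr rfl fun j _ => h1 j, Finset.sum_add_distrib]
    congr 1
    rw [Finset.sum_comm]
    refine Finset.sum_congr rfl fun i _ => ?_
    rw [hexp_u, Finset.mul_sum]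
  rw [key]
  exact Submodule.add_mem_sup
    (Submodule.sum_mem _ fun j _ => Ideal.mul_mem_right _ _ (hΔ0mem j))
    (Submodule.sum_mem _ fun i _ => hDterm i)

end ContentRefined

/-- **Registered stub `content_le_map_univ_sup_of_rich`** (V1, the refined reverse inclusion of
the round lemma): when `R` is rich in `ℤ`-derivations (with dual derivations `D_i` of `u`), the
log-content of `φ(a)` lies in the extension of the full log-content `C_univ(a; R)` plus the
explicit boundary terms `∑_i I_i · (φ(D_i a))`. [folklore] -/
theorem content_le_map_univ_sup_of_rich : ∀ {R S : Type} [CommRing R] [CommRing S] [Algebra ℤ R] [Algebra ℤ S] (φ : R →+* S), (∀ (N : Type) [CommRing N] (ψ : R →+* N) (δ₀ : R →+ N), (∀ a b, δ₀ (a * b) = ψ a * δ₀ b + ψ b * δ₀ a) → ∀ Y : Finset R, ∃ (m : ℕ) (Δ : Fin m → Derivation ℤ R R) (nn : Fin m → N), ∀ y ∈ Y, δ₀ y = Finset.univ.sum fun j => ψ (Δ j y) * nn j) → ∀ {d d' : ℕ} (u : Fin d → R) (D : Fin d → Derivation ℤ R R), (∀ i j, D i (u j) = if i = j then 1 else 0)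 → ∀ (u' : Fin d' → S) (E' : Finset (Fin d')) (a : R), Ideal.span {b | ∃ δ' : Derivation ℤ S S, (∀ j ∈ E', δ' (u' j) ∈ Ideal.span {u' j}) ∧ δ' (φ a) = b} ≤ (Ideal.span {b | ∃ δ : Derivation ℤ R R, (∀ i ∈ (Finset.univ : Finset (Fin d)), δ (u i) ∈ Ideal.span {u i}) ∧ δ a = b}).map φ ⊔ ⨆ i : Fin d, Ideal.span {b | ∃ δ' : Derivation ℤ S S, (∀ j ∈ E', δ' (u' j) ∈ Ideal.span {u' j}) ∧ δ' (φ (u i)) = b} * Ideal.span {φ (D i a)} :=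
  by
  intro R S _ _ _ _ φ hrich d d' u D hD u' E' a
  exact content_le_map_sup_of_rich_aux φ hrich u Finset.univ D hD u' E' a

end Summit.ResolutionOfSingularities.ResolutionOfSingularities.Theorems.PfaffLine
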